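import Summits.ABC.IUTFork.Thm311RealDegreeM
import Summits.ABC.IUTFork.Cor312ThetaFiniteMGood
import HarnessLib

/-!
# [IUTchIII] Corollary 3.12, statement — "`−|log(Θ)|` is finite" for the M-LEVEL real setting with the PACKET-NORMALISED
# verbatim volumes (the SUMMAND route `settingPrVolM`): `HullDefined`, arch-zero, good-place-zero and `ThetaFinite` from
# three Θ-box conditions (G1-Θ unit P5, summand route, of `HOME/staging/w5/w5-d166/g4/G1-THETA-SHAPES.md`, C-R12 (e) «#2′»)

PROOF-ONLY record file (D-0012; no definitions, no `Prop` facts) of the abc-iut cell (R2 S-chain seat abc-iut-s2-p9,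
gen 0; branch C «abc ⇐ S»). TAKES NO SIDE on [IUTchIII] Cor. 3.12. This seat's `Cor312ThetaFiniteM` /
`Cor312ThetaFiniteMGood` (p436943, p437512) prove `HullDefined` / the good-place hull / `ThetaFinite` for every
`Cor312.Setting.ofFrames` over abc-iut-w5-d166's M-level field-box pieces `frameVolumePiecesOfInitialDH D hlog` and a
`Situation.ofShells` with ARBITRARY `Adm`/`logvol` — the FRAMES route (`settingMSharp`, `Cor312ThetaFiniteMSharp` p437661).
abc-iut-w4-d013's SUMMAND-route setting `Real.settingPrVolM` (`Cor312SettingPrVolM`, p435693: abc-iut-c312-7's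
`Setting.ofComparison` over the probability-weighted verbatim container `summandPiecesPrM`; the route of abc-iut-c312-7's
F-level `settingPrVolSharp` named by branch C's READ binder `hΘ`, and the route on which abc-iut-c312-6's `BridgeHyps` is
available, `bridgeHyps_settingPrVolM`) IS such a `Setting.ofFrames` term BY `rfl` (`settingPrVolM_eq_ofFrames`: same frames
`(ofLocalFields _).comap factorMapM`, same glue, `hadm := hadm_PrM`), so:

* §1 `settingPrVolM_eq_ofFrames` (`rfl`); `hullDefined_settingPrVolM` (every `(j, v_ℚ)`, from BOUNDED and NONDEGENERATE
  Θ-boxes at the finite places — unit P5a verbatim), `thetaLocal_ne_top_settingPrVolM`, `thetaHull_adm_settingPrVolM`;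
* §2 the two volume facts in the SUMMAND container (abc-iut-c312-5's `SummandPieces`, not `FrameVolumePieces.Realizes`):
  `thetaLocal_settingPrVolM_arc = 0` (trivial archimedean container, abc-iut-w5-d244/w4-d013's `logvol_summandPiecesPrM_arc`),
  `logvol_situationPrVolM_preimage_normalizedPacket = 0` and **`thetaLocal_settingPrVolM_eq_zero`** at a GOOD place
  (`p_u > 2`, `p_u ∤ disc(K)`, `j ∈ 𝔽_l^⋇`, boxes `= 𝒪_L`: hull `= e⁻¹(Π_{v⃗} (R_{v⃗})^∼)` by unit P5a's
  `thetaHull_ofFramesM_eq_of_good`, of weighted log-measure `Σ_{v⃗} w·log μ̄((R_{v⃗})^∼) = 0` — [IUTchIV] Thm. 1.10 Step (vi));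
* §3 **`thetaFinite_settingPrVolM`** from the three Θ-box conditions (bounded, nondegenerate at every `(j ∈ 𝔽_l^⋇, u)`;
  unit polydisc off a finite set of finite places of `ℚ`) — the M-level twin of abc-iut-c312-7's `thetaFinite_settingPrVol`
  (p421738) on the route of record. The sharp instance (Θ-boxes read off ideles, `BridgeHyps`) is the companion
  `Cor312ThetaFinitePrVolMSharp`.

[claim: Mochizuki2012, status: disputed] for the quoted setting; [cite: DupuyHilado2025, §3.6, §4 (intro), §4.10];
[cite: Mochizuki2012, IUTchIV Thm 1.10 proof Step (vi) p. 29]. HONEST FRAMING: bookkeeping at the genuine carriers; nothing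
here bears on the truth of [IUTchIII] Cor. 3.12 (`Cor312.Setting.Statement` untouched); typed ≠ proved; instantiated ≠ endorsed.
-/

noncomputable section

open Set Function NumberField IsDedekindDomain Bornology
open scoped Pointwise

namespace Summit.ABC.IUTFork.Thm311.Real

open Cor312 Cor312Vol Literature.IUT.LogThetaLattice Literature.IUT.LogVolume Literature.IUT.HodgeTheaters
  Literature.NumberTheory.NumberFields

variable {F K Fbar : Type} [Field F] [NumberField F] [Field K] [NumberField K] [Algebra F K]
  [Field Fbar] [Algebra F Fbar] [Algebra K Fbar] {E : WeierstrassCurve F} [E.IsElliptic] {l : ℕ}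
  {Pb : BadPlacePredicates K} (D : InitialThetaData F K Fbar E l Pb) {logvK : PadicLogsVal K}
  (hlog : LogvAnalyticVal logvK)

section Setting

variable (M : Type) [Field M] [NumberField M]
  (archPk : ∀ (j : (thetaIndexOfInitial D).Label) (vQ : (thetaIndexOfInitial D).VQ),
    Set ((logShellsOfInitialDH D logvK).Packet j vQ))
  (archSub : ∀ (j : (thetaIndexOfInitial D).Label) (v : (thetaIndexOfInitial D).V),
    Set ((logShellsOfInitialDH D logvK).Packet j ((thetaIndexOfInitial D).over v)))
  (Ψ : ℤ → ∀ v : (thetaIndexOfInitial D).V, v ∈ (thetaIndexOfInitial D).Vbad →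
    Set ((logShellsOfInitialDH D logvK).StarPacket v))
  (act : ℤ → ∀ v : (thetaIndexOfInitial D).V, v ∈ (thetaIndexOfInitial D).Vbad →
    (logShellsOfInitialDH D logvK).StarPacket v → Module.End ℚ ((logShellsOfInitialDH D logvK).StarPacket v))
  (Mmod : ℤ → ∀ j : (thetaIndexOfInitial D).LabelStar, Set ((logShellsOfInitialDH D logvK).GlobalPacket j.1))
  (region : ℤ → ∀ j : (thetaIndexOfInitial D).LabelStar, FinDivisor M → ∀ vQ : (thetaIndexOfInitial D).VQ,
    Set ((logShellsOfInitialDH D logvK).Packet j.1 vQ))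
  (n : ℤ) {HT : Type} {LogLink : HT → HT → Type} {IsFull : ∀ {s t : HT}, LogLink s t → Prop}
  (lat : LGPGaussianLogThetaLattice LogLink IsFull)
  {Frd : Type} {IsoF : Frd → Frd → Type} {Ob : Frd → Type} {realify : Frd → Frd} {Strip : Type}
  {IsoS : Strip → Strip → Type} {Mv : ∀ v : (thetaIndexOfInitial D).V, v ∈ (thetaIndexOfInitial D).Vbad → Type}
  [∀ v h, Monoid (Mv v h)]
  (sig : GlobalLGPFrobenioidSignature (thetaIndexOfInitial D).lstar (thetaIndexOfInitial D).V
    (· ∈ (thetaIndexOfInitial D).Vbad) Frd IsoF Ob realify Strip IsoS Mv)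
  (split : SplittingMonoids Mv) {ObΔ : Type} {N : ∀ v : (thetaIndexOfInitial D).V, v ∈ (thetaIndexOfInitial D).Vbad → Type}
  [∀ v h, Monoid (N v h)] (qData : QPilotData ObΔ N)
  (thetaBox : ℤ → Ob sig.Clgp → ∀ (j : (thetaIndexOfInitial D).Label) (vQ : (thetaIndexOfInitial D).VQ),
    Set (∀ s : factorIdxM D hlog j vQ, factorFieldM D hlog j vQ s))
  (qCentre : ObΔ → ∀ (j : (thetaIndexOfInitial D).Label) (vQ : (thetaIndexOfInitial D).VQ),
    ∀ s : factorIdxM D hlog j vQ, factorFieldM D hlog j vQ s)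
  (hq : ∀ j vQ s, qCentre (qPilotObject qData) j vQ s ≠ 0)
  (hfin : ∀ j : (thetaIndexOfInitial D).Label, (Function.support fun vQ =>
    ((situationPrVolM D hlog M archPk archSub Ψ act Mmod region).D n).logvol j vQ
      (factorMapM D hlog j vQ ⁻¹' hullSet (factorFieldM D hlog j vQ) (qCentre (qPilotObject qData) j vQ))).Finite)

/-! ## §1. The summand-route setting IS a per-frame assembly over the field-box pieces; `HullDefined` -/

/-- **`settingPrVolM` IS abc-iut-c312-7's `Setting.ofFrames` over abc-iut-w5-d166's field-box pieces** at the summand-route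
situation, with the same Θ-box / `q`-centre binders and `hadm := hadm_PrM` (abc-iut-c312-7's `Setting.ofComparison` and
`Setting.ofFrames` build the same frames `(ofLocalFields _).comap factorMapM` and the same glue; by `rfl`). So every theorem of
this seat's `Cor312ThetaFiniteM`/`…MGood` (stated over `Situation.ofShells … Adm logvol …` with ARBITRARY `Adm`/`logvol`) reads
the summand-route setting verbatim. [folklore] -/
theorem settingPrVolM_eq_ofFrames :
    settingPrVolM D hlog M archPk archSub Ψ act Mmod region n lat sig split qData thetaBox qCentre hq hfin =
      Setting.ofFrames n lat sig split qData
        ((frameVolumePiecesOfInitialDH D hlog).toRealFrames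
          (S := Situation.ofShells (logShellsOfInitialDH D logvK) M archPk archSub (summandPiecesPrM D hlog).Adm
            (summandPiecesPrM D hlog).logvol Ψ act Mmod region)
          thetaBox qCentre) hq (hadm_PrM D hlog M archPk archSub Ψ act Mmod region n) hfin :=
  rfl

/-- **`HullDefined` at EVERY `(j, v_ℚ)` for the summand-route M-level setting** from BOUNDED and NONDEGENERATE Θ-boxes at the
finite places of `ℚ` (unit P5a `hullDefined_ofFramesM`, read through `settingPrVolM_eq_ofFrames`).
[claim: Mochizuki2012, status: disputed] -/
theorem hullDefined_settingPrVolM (j : (thetaIndexOfInitial D).Label)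
    (hbdd : ∀ u : FinitePlace ℚ, Bornology.IsBounded (⋃ m : ℤ, thetaBox m (thetaPilotObject sig split) j (Val.non u)))
    (hnd : ∀ u : FinitePlace ℚ, IsNondegenerate (factorFieldM D hlog j (Val.non u))
      (⋃ m : ℤ, thetaBox m (thetaPilotObject sig split) j (Val.non u))) (vQ : (thetaIndexOfInitial D).VQ) :
    (settingPrVolM D hlog M archPk archSub Ψ act Mmod region n lat sig split qData thetaBox qCentre hq hfin).HullDefined j vQ :=
  hullDefined_ofFramesM D hlog M archPk archSub (summandPiecesPrM D hlog).Adm (summandPiecesPrM D hlog).logvol Ψ act Mmod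
    region n lat sig split qData thetaBox qCentre hq (hadm_PrM D hlog M archPk archSub Ψ act Mmod region n) hfin j hbdd hnd vQ

/-- `HullDefined` at the archimedean place, unconditionally (empty factor index). [claim: Mochizuki2012, status: disputed] -/
theorem hullDefined_settingPrVolM_arc (j : (thetaIndexOfInitial D).Label) (w : InfinitePlace ℚ) :
    (settingPrVolM D hlog M archPk archSub Ψ act Mmod region n lat sig split qData thetaBox qCentre hq hfin).HullDefined j
      (Val.arc w) :=
  hullDefined_ofFramesM_arc D hlog M archPk archSub (summandPiecesPrM D hlog).Adm (summandPiecesPrM D hlog).logvol Ψ act Mmod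
    region n lat sig split qData thetaBox qCentre hq (hadm_PrM D hlog M archPk archSub Ψ act Mmod region n) hfin j w

/-- `HullDefined` at a finite place from bounded nondegenerate Θ-boxes there. [claim: Mochizuki2012, status: disputed] -/
theorem hullDefined_settingPrVolM_non (j : (thetaIndexOfInitial D).Label) (u : FinitePlace ℚ)
    (hbdd : Bornology.IsBounded (⋃ m : ℤ, thetaBox m (thetaPilotObject sig split) j (Val.non u)))
    (hnd : IsNondegenerate (factorFieldM D hlog j (Val.non u))
      (⋃ m : ℤ, thetaBox m (thetaPilotObject sig split) j (Val.non u))) :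
    (settingPrVolM D hlog M archPk archSub Ψ act Mmod region n lat sig split qData thetaBox qCentre hq hfin).HullDefined j
      (Val.non u) :=
  hullDefined_ofFramesM_non D hlog M archPk archSub (summandPiecesPrM D hlog).Adm (summandPiecesPrM D hlog).logvol Ψ act Mmod
    region n lat sig split qData thetaBox qCentre hq (hadm_PrM D hlog M archPk archSub Ψ act Mmod region n) hfin j u hbdd hnd

/-- The local Θ-volume of the summand-route M-level setting is a real number at every `(j, v_ℚ)`.
[claim: Mochizuki2012, status: disputed] -/
theorem thetaLocal_ne_top_settingPrVolM (j : (thetaIndexOfInitial D).Label)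
    (hbdd : ∀ u : FinitePlace ℚ, Bornology.IsBounded (⋃ m : ℤ, thetaBox m (thetaPilotObject sig split) j (Val.non u)))
    (hnd : ∀ u : FinitePlace ℚ, IsNondegenerate (factorFieldM D hlog j (Val.non u))
      (⋃ m : ℤ, thetaBox m (thetaPilotObject sig split) j (Val.non u))) (vQ : (thetaIndexOfInitial D).VQ) :
    (settingPrVolM D hlog M archPk archSub Ψ act Mmod region n lat sig split qData thetaBox qCentre hq hfin).thetaLocal j vQ ≠ ⊤ :=
  thetaLocal_ne_top_ofFramesM D hlog M archPk archSub (summandPiecesPrM D hlog).Adm (summandPiecesPrM D hlog).logvol Ψ act Mmod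
    region n lat sig split qData thetaBox qCentre hq (hadm_PrM D hlog M archPk archSub Ψ act Mmod region n) hfin j hbdd hnd vQ

/-- The hull `^{n,∘}𝒰_{j,v_ℚ}` of the summand-route M-level setting is an admissible region of the verbatim container.
[claim: Mochizuki2012, status: disputed] -/
theorem thetaHull_adm_settingPrVolM (j : (thetaIndexOfInitial D).Label)
    (hbdd : ∀ u : FinitePlace ℚ, Bornology.IsBounded (⋃ m : ℤ, thetaBox m (thetaPilotObject sig split) j (Val.non u)))
    (hnd : ∀ u : FinitePlace ℚ, IsNondegenerate (factorFieldM D hlog j (Val.non u))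
      (⋃ m : ℤ, thetaBox m (thetaPilotObject sig split) j (Val.non u))) (vQ : (thetaIndexOfInitial D).VQ) :
    ((situationPrVolM D hlog M archPk archSub Ψ act Mmod region).D n).Adm j vQ
      ((settingPrVolM D hlog M archPk archSub Ψ act Mmod region n lat sig split qData thetaBox qCentre hq hfin).thetaHull j vQ) :=
  thetaHull_adm_ofFramesM D hlog M archPk archSub (summandPiecesPrM D hlog).Adm (summandPiecesPrM D hlog).logvol Ψ act Mmod
    region n lat sig split qData thetaBox qCentre hq (hadm_PrM D hlog M archPk archSub Ψ act Mmod region n) hfin j hbdd hnd vQ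

/-! ## §2. The two volume facts in the summand container: archimedean `0`, good place `0` -/

/-- **The ARCHIMEDEAN local Θ-volume of the summand-route M-level setting is `0`** (trivial archimedean container: every region
has weighted log-measure `0`, abc-iut-w4-d013/w5-d244 `logvol_summandPiecesPrM_arc`; SHAPES unit (A)).
[claim: Mochizuki2012, status: disputed] -/
theorem thetaLocal_settingPrVolM_arc (j : (thetaIndexOfInitial D).Label) (w : InfinitePlace ℚ) :
    (settingPrVolM D hlog M archPk archSub Ψ act Mmod region n lat sig split qData thetaBox qCentre hq hfin).thetaLocal j
        (Val.arc w) = ((0 : ℝ) : WithTop ℝ) := by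
  unfold Setting.thetaLocal
  rw [if_pos (hullDefined_settingPrVolM_arc D hlog M archPk archSub Ψ act Mmod region n lat sig split qData thetaBox qCentre hq
    hfin j w)]
  congr 1
  exact logvol_summandPiecesPrM_arc D hlog j w _

/-- The weighted log-measure of `e⁻¹(Π_{v⃗} (R_{v⃗})^∼)` in the M-level probability-weighted container VANISHES at every finite
place (`log μ̄((R_{v⃗})^∼) = 0` summand by summand, Dupuy–Hilado (3.6); abc-iut-c312-5's generic
`sum_w_mul_packetLogμ_normalizedPacket`). [cite: DupuyHilado2025, Def. 3.6.1] -/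
theorem logvol_situationPrVolM_preimage_normalizedPacket (j : (thetaIndexOfInitial D).Label) (u : FinitePlace ℚ) :
    ((situationPrVolM D hlog M archPk archSub Ψ act Mmod region).D n).logvol j (Val.non u)
      ((presAtM D hlog u).comparison j ⁻¹' Set.pi univ fun e =>
        (normalizedPacket (ratChar u) ((presAtM D hlog u).kk e) : Set ((presAtM D hlog u).X e))) = 0 := by
  haveI : Fintype ((thetaIndexOfInitial D).Caps j → (thetaIndexOfInitial D).Fibre (Val.non u)) := Fintype.ofFinite _
  refine ((realizes_situationPrVolM D hlog M archPk archSub Ψ act Mmod region n).logvol_eq j (Val.non u) _).trans ?_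
  have h := SummandPieces.logvol_preimage_pi (summandPiecesPrM D hlog) j (Val.non u)
    (R := fun e => (normalizedPacket (ratChar u) ((presAtM D hlog u).kk e) : Set ((presAtM D hlog u).X e)))
    (fun e => (presAtM D hlog u).packetAdm_normalizedPacket_kk e)
  refine h.trans (Finset.sum_eq_zero fun e _ => ?_)
  show (summandPiecesPrM D hlog).w j (Val.non u) e *
    packetLogμ (ratChar u) ((presAtM D hlog u).kk e) (normalizedPacket (ratChar u) ((presAtM D hlog u).kk e)) = 0
  rw [packetLogμ_normalizedPacket, mul_zero]

/-- **At a GOOD place the local Θ-volume of the summand-route M-level setting is `0`**: for `p_u > 2`, `p_u ∤ disc(K)`,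
`j = i+1 ∈ 𝔽_l^⋇` and Θ-boxes equal to the unit polydisc `𝒪_L` at `(j, u)`, the hull of the union of ALL possible images is
`e⁻¹(Π_{v⃗} (R_{v⃗})^∼)` (unit P5a `thetaHull_ofFramesM_eq_of_good`; [IUTchIV] Thm. 1.10 Step (vi) "the “container of possible
images” is precisely equal to the tensor product of log-shells"), of weighted log-measure `0`.
[cite: Mochizuki2012, IUTchIV Thm 1.10 proof Step (vi) p. 29] -/
theorem thetaLocal_settingPrVolM_eq_zero (i : Fin (thetaIndexOfInitial D).lstar) (u : FinitePlace ℚ)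
    (hp2 : 2 < ratChar u) (hdisc : ¬ ((ratChar u : ℕ) : ℤ) ∣ NumberField.discr K)
    (hbox : (⋃ m : ℤ, thetaBox m (thetaPilotObject sig split) (Setting.labelSucc i) (Val.non u)) =
      hullSet (factorFieldM D hlog (Setting.labelSucc i) (Val.non u)) (fun _ => 1)) :
    (settingPrVolM D hlog M archPk archSub Ψ act Mmod region n lat sig split qData thetaBox qCentre hq hfin).thetaLocal
        (Setting.labelSucc i) (Val.non u) = ((0 : ℝ) : WithTop ℝ) := by
  have hHul : IsHullSet (factorFieldM D hlog (Setting.labelSucc i) (Val.non u))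
      (hullSet (factorFieldM D hlog (Setting.labelSucc i) (Val.non u)) (fun _ => 1)) :=
    ⟨fun _ => 1, fun _ => one_ne_zero, rfl⟩
  have hHD : (settingPrVolM D hlog M archPk archSub Ψ act Mmod region n lat sig split qData thetaBox qCentre hq
        hfin).HullDefined (Setting.labelSucc i) (Val.non u) :=
    hullDefined_settingPrVolM_non D hlog M archPk archSub Ψ act Mmod region n lat sig split qData thetaBox qCentre hq hfin _ u
      (by rw [hbox]; exact isBounded_hullSet _ _) (by rw [hbox]; exact hHul.isNondegenerate)
  unfold Setting.thetaLocal
  rw [if_pos hHD, settingPrVolM_eq_ofFrames,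
    thetaHull_ofFramesM_eq_of_good D hlog M archPk archSub (summandPiecesPrM D hlog).Adm (summandPiecesPrM D hlog).logvol Ψ
      act Mmod region n lat sig split qData thetaBox qCentre hq (hadm_PrM D hlog M archPk archSub Ψ act Mmod region n) hfin i u
      hp2 hdisc hbox,
    (presAtM D hlog u).latticePk_one_eq_of_unramified hp2 (two_le_card_caps_labelSucc_M D i)
      (absRamificationIdx_presAtM_eq_one D hlog u hdisc)]
  exact congrArg _ (logvol_situationPrVolM_preimage_normalizedPacket D hlog M archPk archSub Ψ act Mmod region n
    (Setting.labelSucc i) u)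

/-! ## §3. `ThetaFinite` -/

/-- **`ThetaFinite` for the summand-route M-LEVEL real setting over the genuine carriers `K_{v̲}`, from three Θ-box conditions**:
bounded and nondegenerate boxes at every `(j ∈ 𝔽_l^⋇, u)` (⇒ every local Θ-volume is a real number, §1), and boxes equal to the
unit polydisc off a finite set of finite places of `ℚ` (⇒ zero local Θ-volume at every further place whose prime does not divide
`2·disc(K)`, §2, so the global sum of [IUTchIII] Prop. 3.9 (iii) is a finite sum). The M-level twin of abc-iut-c312-7's
`thetaFinite_settingPrVol` on the route of record. [claim: Mochizuki2012, status: disputed] -/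
theorem thetaFinite_settingPrVolM
    (hbdd : ∀ (i : Fin (thetaIndexOfInitial D).lstar) (u : FinitePlace ℚ),
      Bornology.IsBounded (⋃ m : ℤ, thetaBox m (thetaPilotObject sig split) (Setting.labelSucc i) (Val.non u)))
    (hnd : ∀ (i : Fin (thetaIndexOfInitial D).lstar) (u : FinitePlace ℚ),
      IsNondegenerate (factorFieldM D hlog (Setting.labelSucc i) (Val.non u))
        (⋃ m : ℤ, thetaBox m (thetaPilotObject sig split) (Setting.labelSucc i) (Val.non u)))
    (hcof : ∀ i : Fin (thetaIndexOfInitial D).lstar, {u : FinitePlace ℚ |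
      (⋃ m : ℤ, thetaBox m (thetaPilotObject sig split) (Setting.labelSucc i) (Val.non u)) ≠
        hullSet (factorFieldM D hlog (Setting.labelSucc i) (Val.non u)) (fun _ => 1)}.Finite) :
    (settingPrVolM D hlog M archPk archSub Ψ act Mmod region n lat sig split qData thetaBox qCentre hq hfin).ThetaFinite := by
  refine ⟨fun i vQ => thetaLocal_ne_top_settingPrVolM D hlog M archPk archSub Ψ act Mmod region n lat sig split qData thetaBox
      qCentre hq hfin (Setting.labelSucc i) (hbdd i) (hnd i) vQ,
    fun i => ?_⟩
  have hD : 2 * (NumberField.discr K).natAbs ≠ 0 :=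
    mul_ne_zero two_ne_zero (Int.natAbs_ne_zero.2 (NumberField.discr_ne_zero K))
  refine ((Set.finite_range Val.arc).union
    (((finite_finitePlace_ratChar_dvd hD).union (hcof i)).image Val.non)).subset ?_
  intro vQ hvQ
  rcases vQ with w | u
  · exact Or.inl ⟨w, rfl⟩
  · refine Or.inr ⟨u, ?_, rfl⟩
    by_contra hu
    simp only [Set.mem_union, Set.mem_setOf_eq, not_or, ne_eq, not_not] at hu
    obtain ⟨hp2, hdisc⟩ := good_of_not_dvd_M (K := K) u hu.1
    have h0 : ((settingPrVolM D hlog M archPk archSub Ψ act Mmod region n lat sig split qData thetaBox qCentre hq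
        hfin).thetaLocal (Setting.labelSucc i) (Val.non u)).untopD 0 = 0 := by
      rw [thetaLocal_settingPrVolM_eq_zero D hlog M archPk archSub Ψ act Mmod region n lat sig split qData thetaBox qCentre hq
          hfin i u hp2 hdisc hu.2,
        WithTop.untopD_coe]
    exact absurd h0 hvQ

end Setting

end Summit.ABC.IUTFork.Thm311.Real

end
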